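import Summits.QuantumFields.BalabanUV.T4Continuum.Support.AveragingDeficitNearIdentity
import Summits.QuantumFields.BalabanUV.T4Continuum.Support.AveragingDeficitPlaqDeriv

/-!
# T⁴ programme, node NE3, route P2 «ENERGY CONVEXITY» — leaf L2 (c) ∕ L7 along the path: the PLAQUETTE RADIUS of a
# right-exponential perturbation `W·e^{A}` of a small-field `U(N)` configuration — `‖(W e^{A})(∂p) − W(∂p)‖ ≤ Σ_{b⊂∂p}
# (e^{‖A(b)‖} − 1)`, hence `SmallField W a ∧ sup‖A‖ ≤ α ⟹ SmallField (W·e^{A}) (a + 4(e^{α} − 1))`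

Eleventh generation of the NE3 prover lineage P2 (unit `b2b-balaban-t4-ne3-p2`; ROUND-2 SKELETON-FIRST mandate).  In
the skeleton `HOME/t4/skeletons/NE3-t4-ne3-p2.md` the admissible path of leaf L2 is `t ↦ W·exp Γ(t)` (tree `vary W (Γ t) 1`)
and two of its uses need the plaquette variables of such configurations to stay near `1`: the class-membership part of
field `adm` of `Support/NE3EnergyAssembly.RouteLeaves` (the path stays in the owner's small-field class `sfClass`) and
leaf L7 along the path (`Support/NE3EnergySource.abs_firstVariation_le` takes the plaquette radius of the CURRENT
configuration).  This file supplies the elementary bound, uniformly in everything: §1 one letter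
(`norm_stepHol_vary_sub_le`: `‖step(W e^{sA}) − step(W)‖ ≤ e^{‖s·A(b)‖} − 1` on `U(N)` data), §2 a word
(`norm_hol_vary_sub_hol_le`: telescoping along the word, all factors of norm `≤ 1` because `W` is unitary and `A` skew),
§3 the plaquette radius (`smallField_vary`: `SmallField W a → (∀ b, ‖A(b)‖ ≤ α) → SmallField (vary W A 1) (a + 4(e^{α} − 1))`,
and the linearised form `a + 8α` for `α ≤ 1`).  All [folklore]; inputs BY NAME: `val_expUnit`, `val_inv_expUnit`,
`mem_U1_of_unitary`, `stepHol_mem`, `hol_mem`, `vary_isUnitaryCfg`, `Literature.Analysis.Calculus.norm_exp_sub_one_le`,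
Mathlib's `Real.abs_exp_sub_one_le`.

HONEST FRAMING.  Finite-T⁴ bookkeeping (rung (B)+1); elementary; NOTHING about Bałaban's minimisers is asserted; no
conditional of the cell is used or hidden; NOT infinite volume ∕ mass gap ∕ Clay ∕ summit progress; NE3 NOT proved.
ABSOLUTE RULE kept: no printed sentence is a hypothesis (context: [Balaban1985Variational] (19)–(22) pp. 281–282).
PLACEMENT: `Summits/QuantumFields/BalabanUV/`; imports the accepted `Support.AveragingDeficitNearIdentity` only; moves nothing.
-/

set_option autoImplicit false

open scoped BigOperators Matrix Matrix.Norms.L2Operator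
open NormedSpace Finset

namespace Summit.QuantumFields.BalabanUV.T4Continuum.NE3EnergyVary

open Literature.MathematicalPhysics.QuantumFieldTheory.Balaban1983to89
open B7Prop1Explicit B7Prop2Explicit MatrixLog UnitaryModel
open T4AveragingDeficitWall hiding Site Plane Plaq Bond
open AveragingDeficitTransport (mem_U1_of_unitary)
open AveragingDeficitPlaqDeriv (vary_isUnitaryCfg)

noncomputable section

variable {d : ℕ} {n : Type*} [Fintype n] [DecidableEq n]

/-! ## §1 One letter -/

/-- In a normed ring, `‖u·v − u‖ ≤ ‖v − 1‖` and `‖v·u − u‖ ≤ ‖v − 1‖` when `‖u‖ ≤ 1`. [folklore] -/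
theorem norm_mul_sub_self_le {𝔸 : Type*} [NormedRing 𝔸] {u v : 𝔸} (hu : ‖u‖ ≤ 1) :
    ‖u * v - u‖ ≤ ‖v - 1‖ ∧ ‖v * u - u‖ ≤ ‖v - 1‖ := by
  constructor
  · have h : u * v - u = u * (v - 1) := by rw [mul_sub, mul_one]
    rw [h]
    exact (norm_mul_le _ _).trans (by nlinarith [norm_nonneg (v - 1)])
  · have h : v * u - u = (v - 1) * u := by rw [sub_mul, one_mul]
    rw [h]
    exact (norm_mul_le _ _).trans (by nlinarith [norm_nonneg (v - 1)])

/-- **ONE LETTER**: on `U(N)` data and a `𝔲(N)` direction, the transport of `W e^{sA}` across one letter differs from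
that of `W` by at most `e^{‖s·A(b)‖} − 1`, `b` the letter's bond. [folklore] -/
theorem norm_stepHol_vary_sub_le [Nonempty n] {W : B7Prop1Explicit.Site d → Fin d → (Matrix n n ℂ)ˣ}
    (hW : IsUnitaryCfg W) (A : B7Prop1Explicit.Site d → Fin d → Matrix n n ℂ) (s : ℝ)
    (x : B7Prop1Explicit.Site d) (l : Letter d) :
    ‖((stepHol (vary W A s) x l : (Matrix n n ℂ)ˣ) : Matrix n n ℂ) - ((stepHol W x l : (Matrix n n ℂ)ˣ) : Matrix n n ℂ)‖
      ≤ Real.exp ‖(s : ℂ) • A (if l.2 then x else x + l.vec) l.1‖ - 1 := by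
  have hU : ∀ y κ, W y κ ∈ U1 (Matrix n n ℂ) := fun y κ => mem_U1_of_unitary (hW y κ)
  obtain ⟨μ, b⟩ := l
  cases b
  · -- backward letter: `e^{−sA} W⁻¹ − W⁻¹`
    simp only [stepHol, Bool.false_eq_true, ↓reduceIte, vary, mul_inv_rev, Units.val_mul, val_inv_expUnit,
      val_expUnit]
    have hn : ‖(((W (x + Letter.vec (μ, false)) μ)⁻¹ : (Matrix n n ℂ)ˣ) : Matrix n n ℂ)‖ ≤ 1 :=
      (mem_U1.mp (hU _ _)).2
    refine (norm_mul_sub_self_le hn).2.trans ?_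
    refine (Literature.Analysis.Calculus.norm_exp_sub_one_le _).trans (le_of_eq ?_)
    rw [norm_neg]
  · -- forward letter: `W e^{sA} − W`
    simp only [stepHol, ↓reduceIte, vary, Units.val_mul, val_expUnit]
    have hn : ‖((W x μ : (Matrix n n ℂ)ˣ) : Matrix n n ℂ)‖ ≤ 1 := (mem_U1.mp (hU _ _)).1
    exact (norm_mul_sub_self_le hn).1.trans (Literature.Analysis.Calculus.norm_exp_sub_one_le _)

/-- The perturbed configuration is `U1`-valued (unitary `W`, skew `A`: tree `vary_isUnitaryCfg`). [folklore] -/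
theorem vary_mem_U1 [Nonempty n] {W : B7Prop1Explicit.Site d → Fin d → (Matrix n n ℂ)ˣ} (hW : IsUnitaryCfg W)
    {A : B7Prop1Explicit.Site d → Fin d → Matrix n n ℂ} (hA : IsSkewDir A) (s : ℝ) :
    ∀ y κ, vary W A s y κ ∈ U1 (Matrix n n ℂ) :=
  fun y κ => mem_U1_of_unitary (vary_isUnitaryCfg hW hA s y κ)

/-! ## §2 A word: telescoping -/

/-- The letterwise budget of a word: `Σ_{letters} (e^{‖s·A(b)‖} − 1)`. [folklore] -/
def wordBudget (A : B7Prop1Explicit.Site d → Fin d → Matrix n n ℂ) (s : ℝ) :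
    B7Prop1Explicit.Site d → List (Letter d) → ℝ
  | _, [] => 0
  | x, l :: w => (Real.exp ‖(s : ℂ) • A (if l.2 then x else x + l.vec) l.1‖ - 1) + wordBudget A s (x + l.vec) w

/-- **A WORD**: `‖(W e^{sA})(Γ) − W(Γ)‖ ≤ wordBudget` — telescoping `‖a₁a₂ − b₁b₂‖ ≤ ‖a₁ − b₁‖ + ‖a₂ − b₂‖` for
factors of norm `≤ 1`. [folklore] -/
theorem norm_hol_vary_sub_hol_le [Nonempty n] {W : B7Prop1Explicit.Site d → Fin d → (Matrix n n ℂ)ˣ}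
    (hW : IsUnitaryCfg W) {A : B7Prop1Explicit.Site d → Fin d → Matrix n n ℂ} (hA : IsSkewDir A) (s : ℝ) :
    ∀ (x : B7Prop1Explicit.Site d) (w : List (Letter d)),
      ‖((hol (vary W A s) x w : (Matrix n n ℂ)ˣ) : Matrix n n ℂ) - ((hol W x w : (Matrix n n ℂ)ˣ) : Matrix n n ℂ)‖
        ≤ wordBudget A s x w
  | x, [] => by simp [wordBudget]
  | x, l :: w => by
    rw [hol_cons, hol_cons, Units.val_mul, Units.val_mul, wordBudget]
    have hU : ∀ y κ, W y κ ∈ U1 (Matrix n n ℂ) := fun y κ => mem_U1_of_unitary (hW y κ)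
    have ih := norm_hol_vary_sub_hol_le hW hA s (x + l.vec) w
    have h1 := norm_stepHol_vary_sub_le hW A s x l
    -- ‖a₁ a₂ − b₁ b₂‖ ≤ ‖a₁ − b₁‖‖a₂‖ + ‖b₁‖‖a₂ − b₂‖
    set a₁ := ((stepHol (vary W A s) x l : (Matrix n n ℂ)ˣ) : Matrix n n ℂ)
    set b₁ := ((stepHol W x l : (Matrix n n ℂ)ˣ) : Matrix n n ℂ)
    set a₂ := ((hol (vary W A s) (x + l.vec) w : (Matrix n n ℂ)ˣ) : Matrix n n ℂ)
    set b₂ := ((hol W (x + l.vec) w : (Matrix n n ℂ)ˣ) : Matrix n n ℂ)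
    have ha₂ : ‖a₂‖ ≤ 1 := (mem_U1.mp (hol_mem (vary_mem_U1 hW hA s) (x + l.vec) w)).1
    have hb₁ : ‖b₁‖ ≤ 1 := (mem_U1.mp (stepHol_mem hU x l)).1
    have hsplit : a₁ * a₂ - b₁ * b₂ = (a₁ - b₁) * a₂ + b₁ * (a₂ - b₂) := by noncomm_ring
    calc ‖a₁ * a₂ - b₁ * b₂‖ = ‖(a₁ - b₁) * a₂ + b₁ * (a₂ - b₂)‖ := by rw [hsplit]
      _ ≤ ‖a₁ - b₁‖ * ‖a₂‖ + ‖b₁‖ * ‖a₂ - b₂‖ :=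
          (norm_add_le _ _).trans (add_le_add (norm_mul_le _ _) (norm_mul_le _ _))
      _ ≤ ‖a₁ - b₁‖ * 1 + 1 * ‖a₂ - b₂‖ :=
          add_le_add (mul_le_mul_of_nonneg_left ha₂ (norm_nonneg _)) (mul_le_mul_of_nonneg_right hb₁ (norm_nonneg _))
      _ ≤ _ := by rw [mul_one, one_mul]; exact add_le_add h1 ih

/-- The budget of a word under a SUP bound `‖A(b)‖ ≤ α` at `s = 1`: `≤ length · (e^{α} − 1)`. [folklore] -/
theorem wordBudget_le_of_sup {A : B7Prop1Explicit.Site d → Fin d → Matrix n n ℂ} {α : ℝ} (hA : ∀ y κ, ‖A y κ‖ ≤ α) :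
    ∀ (x : B7Prop1Explicit.Site d) (w : List (Letter d)), wordBudget A 1 x w ≤ w.length * (Real.exp α - 1)
  | x, [] => by simp [wordBudget]
  | x, l :: w => by
    rw [wordBudget, List.length_cons, Nat.cast_succ, add_mul, one_mul]
    have ih := wordBudget_le_of_sup hA (x + l.vec) w
    have h1 : Real.exp ‖((1 : ℝ) : ℂ) • A (if l.2 then x else x + l.vec) l.1‖ - 1 ≤ Real.exp α - 1 := by
      rw [Complex.ofReal_one, one_smul]
      exact sub_le_sub_right (Real.exp_le_exp.mpr (hA _ _)) 1
    linarith

/-! ## §3 The plaquette radius of `W·e^{A}` -/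

/-- **PLAQUETTE RADIUS OF THE PERTURBED CONFIGURATION**: `SmallField W a`, `W` unitary, `A` skew with `‖A(b)‖ ≤ α`
everywhere ⟹ `SmallField (vary W A 1) (a + 4(e^{α} − 1))`. [folklore] -/
theorem smallField_vary [Nonempty n] {W : B7Prop1Explicit.Site d → Fin d → (Matrix n n ℂ)ˣ} (hW : IsUnitaryCfg W)
    {a : ℝ} (hWa : SmallField W a) {A : B7Prop1Explicit.Site d → Fin d → Matrix n n ℂ} (hA : IsSkewDir A) {α : ℝ}
    (hAα : ∀ y κ, ‖A y κ‖ ≤ α) : SmallField (vary W A 1) (a + 4 * (Real.exp α - 1)) := by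
  intro x κ κ' hκ
  have h1 := norm_hol_vary_sub_hol_le hW hA 1 x (plaqWord κ κ')
  have h2 := wordBudget_le_of_sup hAα x (plaqWord κ κ' : List (Letter d))
  have hlen : (plaqWord κ κ' : List (Letter d)).length = 4 := by simp [plaqWord]
  rw [hlen] at h2
  have h3 := hWa x κ κ' hκ
  calc ‖((hol (vary W A 1) x (plaqWord κ κ') : (Matrix n n ℂ)ˣ) : Matrix n n ℂ) - 1‖
      ≤ ‖((hol (vary W A 1) x (plaqWord κ κ') : (Matrix n n ℂ)ˣ) : Matrix n n ℂ)
          - ((hol W x (plaqWord κ κ') : (Matrix n n ℂ)ˣ) : Matrix n n ℂ)‖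
        + ‖((hol W x (plaqWord κ κ') : (Matrix n n ℂ)ˣ) : Matrix n n ℂ) - 1‖ := norm_sub_le_norm_sub_add_norm_sub _ _ _
    _ ≤ (4 : ℕ) * (Real.exp α - 1) + a := add_le_add (h1.trans h2) h3
    _ = a + 4 * (Real.exp α - 1) := by push_cast; ring

/-- Linearised form: for `α ≤ 1`, `e^{α} − 1 ≤ 2α`, so the radius grows by at most `8α`. [folklore] -/
theorem smallField_vary_linear [Nonempty n] {W : B7Prop1Explicit.Site d → Fin d → (Matrix n n ℂ)ˣ} (hW : IsUnitaryCfg W)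
    {a : ℝ} (hWa : SmallField W a) {A : B7Prop1Explicit.Site d → Fin d → Matrix n n ℂ} (hA : IsSkewDir A) {α : ℝ}
    (hα0 : 0 ≤ α) (hα1 : α ≤ 1) (hAα : ∀ y κ, ‖A y κ‖ ≤ α) : SmallField (vary W A 1) (a + 8 * α) := by
  have h := smallField_vary hW hWa hA hAα
  have hexp : Real.exp α - 1 ≤ 2 * α := by
    have h1 := Real.abs_exp_sub_one_le (x := α) (by rwa [abs_of_nonneg hα0])
    rw [abs_of_nonneg hα0] at h1
    exact (le_abs_self _).trans h1
  intro x κ κ' hκ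
  exact (h x κ κ' hκ).trans (by linarith)

end

end Summit.QuantumFields.BalabanUV.T4Continuum.NE3EnergyVary
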